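import Literature.Barriers.PneNP.MCSPHardnessObstructionsPadding
import Literature.Computability.Complexity.ExpClosure
import HarnessLib

/-!
# Murray–Williams 2017, Theorem 4.1, proved: `MurrayWilliams2017_thm_4_1_holds`

D-0014 discharge of the named fact `Literature.Barriers.PneNP.MurrayWilliams2017_thm_4_1`
(`MCSPHardnessObstructions.lean`): "If every sparse language in `NP` has a polynomial-time
reduction to MCSP, then `EXP ⊆ P/poly ⟹ EXP = NEXP`" (C. D. Murray, R. R. Williams, Theory of
Computing 13 (2017), Thm. 4.1, p. 14 = CCC 2015, Thm. 4.1, pp. 374–375), over the tree's `NP`,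
`IsSparseLanguage`, `≤ₚ`, `MCSP`, `EXP`, `NEXP`, `PPoly`.

The printed proof: "Let `L ∈ NTIME(2^{n^c})` … It is enough to show that `L ∈ EXP`. Define the
padded language `L' := {x01^{2^{|x|^c}} | x ∈ L}`. The language `L'` is then a sparse language in
`NP`. By assumption, there is a polynomial time reduction from `L'` to MCSP. Composing … we have a
`2^{c'·n^c}`-time reduction `R` from `n`-bit instances of `L` to `2^{c'·n^c}`-bit instances of MCSP
… `BITS_R := {(x, i) | the i-th bit of R(x) is 1}`. `BITS_R` is clearly in `EXP`. Since
`EXP ⊆ P/poly`, … the truth tables output by `R(x)` all have circuit complexity at most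
`e · s(|x|)` … On input `x`, run the reduction `R(x)`, obtaining an exponential sized instance
`⟨T, k⟩` of MCSP. If `k > e · s(|x|)` then accept. Otherwise, cycle through every circuit `E` of
size at most `k` … Producing the truth table `T` takes exponential time, and checking all
`2^{O(s(n) log s(n))}` circuits of size `O(s(n))` on all polynomial sized inputs to the truth table
also takes exponential time. As a result `L ∈ EXP`."

The Lean proof follows it, assembled from:

* `NTIMEPadding.lean`: `NTIME(2^{nᵏ}) ↝ NTIME(2ⁿ)` by the polynomial pad `padPre`
  (`karpReducible_padPre`, `padPre_mem_NTIME_two_pow`), so that the seed is `L ∈ NTIME(2ⁿ)` and the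
  pad is the linear-exponential `lpad 1` of `ExpTimeMaps.lean`;
* `MCSPHardnessObstructionsPadding.lean`: the SPARSE `NP` language `L♯` with
  `x ∈ L ↔ lpad 1 x ∈ L♯` (`KarpAssembly.exists_sparse_pad_mem_NP`) — "`L'` is a sparse language in
  `NP`"; the hypothesis then gives `f ∈ FP` reducing `L♯` to `MCSP`, and `g = f ∘ lpad 1 ∈ FE` is `R`;
* `MCSPHardnessObstructionsProofs.lean` (Steps 2–4 of the counting route, which ARE Murray–Williams'
  mechanism): `BITS_R ∈ EXP ⊆ P/poly` (`preimage_mem_EXP`, `BitLang_mem_P`) gives small circuits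
  for the output truth tables (`exists_cktSize_bits`), hence short certificates of the tree's `MCSP`
  verifier `Ver` (`complete_short`) and the projection form
  `x ∈ L ↔ ∃ y, |y| ≤ r(|x|) ∧ ⟨g x, y⟩ ∈ Ver` (`KarpAssembly.exists_projection_form`, applied to
  the reduction `f ∘ lpad 1 ∘ logTruncFn` of the truncation language) — the certificate `y` IS a
  circuit of size `≤ k` agreeing with `T`, so "cycle through every circuit" is the search over `y`;
* `ExpClosure.lean`: that search in exponential time, `∃ᵖ·EXP ⊆ EXP`
  (`polyExists_EXP_subset_EXP`, the verifier language `(mapFst g)⁻¹(Ver)` being in `EXP`), the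
  closure of `EXP` under the Karp reduction to `padPre` (`mem_EXP_of_karpReducible`), and
  `EXP ⊆ NEXP` for the other inclusion.

Main results: `KarpAssembly.NTIME_two_pow_subset_EXP_of`, `NEXP_subset_EXP_of_sparse_reducible`,
**`MurrayWilliams2017_thm_4_1_holds`** and the corollary `exp_eq_nexp_of_isNPHard_MCSP`
(`exp_eq_nexp_of_isNPHard` of the statement file fed with the discharge). Thm. 1.6 itself, the
barrier fact `MCSPKarpHardness`, is proved UNCONDITIONALLY in `MCSPHardnessObstructionsProofs.lean`
(`MCSPKarpHardness_holds`, the counting route), so its printed proof — Thm. 4.1 plus the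
nondeterministic time hierarchy theorem — is not restated here as a conditional theorem: it is the
term `MCSPKarpHardness.of_thm_4_1 MurrayWilliams2017_thm_4_1_holds hH` for `hH : ¬ (NEXP ⊆ NP)`,
resp. `MCSPKarpHardness.of_facts MurrayWilliams2017_thm_4_1_holds hH NP_subset_NTIME_two_pow` for
`hH : ntime_hierarchy` (`MCSPHardnessObstructionsProofs.lean`, `NPSubsetNTIME.lean`).

## References

* C. D. Murray, R. R. Williams, *On the (non) NP-hardness of computing circuit complexity*,
  Theory of Computing 13 (2017), Thm. 4.1 (p. 14); CCC 2015, LIPIcs 33, Thm. 4.1, pp. 374–375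
  (held: `paper:doi-10-4086-toc-2017-v013a004`, `paper:doi-10-4230-lipics-ccc-2015-365`).
* S. Arora, B. Barak, *Computational Complexity: A Modern Approach*, CUP 2009, §2.6.2, Claim 2.4.
-/

namespace Literature.Barriers.PneNP

open _root_.Computability Literature.Computability.Complexity
  Literature.Computability.Complexity.Nondeterministic Literature.Computability.MetaComplexity
open scoped Literature.Computability.Complexity.Notation

namespace KarpAssembly

open MCSPVerif

/-- **`NTIME(2ⁿ) ⊆ EXP` under the hypotheses of Thm. 4.1** (the printed proof for an `NTIME(2ⁿ)`
seed). Let `L ∈ NTIME(2ⁿ)`; take the sparse `NP` pad `L♯` (`exists_sparse_pad_mem_NP`) and, by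
hypothesis, `f ∈ FP` reducing `L♯` to `MCSP`, so `x ∈ L ↔ g x ∈ MCSP` for `g = f ∘ lpad 1 ∈ FE`
(the reduction `R`). The bit language of `g` is in `EXP ⊆ P/poly` and the verifier language
`(mapFst g)⁻¹(Ver)` is in `EXP` (`ExpTimeMaps.lean`); by `exists_projection_form` (applied to the
`FP` reduction `f ∘ lpad 1 ∘ logTruncFn` of the truncation language `logTruncLang L`, which agrees
with `g` on pads), `x ∈ L ↔ ∃ y, |y| ≤ r(|x|) ∧ ⟨x, y⟩ ∈ (mapFst g)⁻¹(Ver)` — the certificates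
being the small circuits for the output truth table —, i.e. `L ∈ ∃ᵖ·EXP = EXP`
(`polyExists_EXP_subset_EXP`: the exhaustive search over those circuits).
[cite: MurrayWilliams2017, Thm. 4.1 (proof, p. 14)] [cite: MurrayWilliams2015, Thm. 4.1 (proof, pp. 374–375)] -/
theorem NTIME_two_pow_subset_EXP_of (hR : ∀ L ∈ NP, IsSparseLanguage L → L ≤ₚ MCSP)
    (hEXP : EXP ⊆ PPoly) : NTIME (fun n => 2 ^ n) ⊆ EXP := by
  intro L hL
  -- the sparse `NP` pad and its reduction to `MCSP`
  obtain ⟨Lp, hLpNP, hsparse, hpad⟩ := exists_sparse_pad_mem_NP hL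
  obtain ⟨f, hf, hred⟩ := polyTimeKarpReducible_iff.1 (hR Lp hLpNP hsparse)
  -- the same reduction, seen on the truncation language
  have hf' : f ∘ (lpad 1 ∘ logTruncFn) ∈ FP := comp_mem_FP hf lpad_comp_logTruncFn_mem_FP
  have hred' : ∀ w, w ∈ logTruncLang L ↔ (f ∘ (lpad 1 ∘ logTruncFn)) w ∈ MCSP := fun w => by
    change logTruncFn w ∈ L ↔ f (lpad 1 (logTruncFn w)) ∈ MCSP
    rw [hpad, hred]
  have hfun : (f ∘ (lpad 1 ∘ logTruncFn)) ∘ lpad 1 = f ∘ lpad 1 :=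
    funext fun x => by simp only [Function.comp_apply, logTruncFn_lpad le_rfl]
  -- `g = f ∘ lpad 1 ∈ FE`: its bit language is in `EXP ⊆ P/poly`, its verifier language in `EXP`
  have hg : f ∘ lpad 1 ∈ FE := comp_mem_FE hf (lpad_mem_FE 1)
  have hB : (mapFstFn (f ∘ lpad 1) ⁻¹' BitLang : Language Bool) ∈ PPoly :=
    hEXP (preimage_mem_EXP (mapFstFn_mem_FE hg) BitLang_mem_P)
  have hV : (mapFstFn (f ∘ lpad 1) ⁻¹' Ver : Language Bool) ∈ EXP :=
    preimage_mem_EXP (mapFstFn_mem_FE hg) Ver_mem_P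
  -- the projection form: the certificates are the small circuits
  obtain ⟨r, hr⟩ := exists_projection_form (L := L) le_rfl hf' hred' (by rw [hfun]; exact hB)
  rw [hfun] at hr
  -- exhaustive search over them: `L ∈ ∃ᵖ·EXP = EXP`
  have hmem : L ∈ polyExists EXP := ⟨_, hV, r, hr⟩
  exact polyExists_EXP_subset_EXP hmem

end KarpAssembly

open KarpAssembly in
/-- **`NEXP ⊆ EXP` under the hypotheses of Thm. 4.1**: an `L ∈ NTIME(2^{nᵏ})` Karp-reduces to its
polynomially padded version `padPre k L ∈ NTIME(2ⁿ)` (`NTIMEPadding.lean`), which is in `EXP` by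
`NTIME_two_pow_subset_EXP_of`, and `EXP` is closed under Karp reductions ("Let
`L ∈ NTIME(2^{n^c})` … It is enough to show that `L ∈ EXP`").
[cite: MurrayWilliams2017, Thm. 4.1 (proof, p. 14)] -/
theorem NEXP_subset_EXP_of_sparse_reducible (hR : ∀ L ∈ NP, IsSparseLanguage L → L ≤ₚ MCSP)
    (hEXP : EXP ⊆ PPoly) : NEXP ⊆ EXP := by
  intro L hL
  simp only [NEXP, Set.mem_iUnion] at hL
  obtain ⟨k, hk⟩ := hL
  exact mem_EXP_of_karpReducible (karpReducible_padPre k L)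
    (NTIME_two_pow_subset_EXP_of hR hEXP (padPre_mem_NTIME_two_pow hk))

/-- **Murray–Williams 2017, Theorem 4.1** (Theory of Computing 13 (2017), p. 14 = CCC 2015,
pp. 374–375): "If every sparse language in `NP` has a polynomial-time reduction to MCSP, then
`EXP ⊆ P/poly ⟹ EXP = NEXP`" — the discharge of the named fact `MurrayWilliams2017_thm_4_1`
(`EXP ⊆ NEXP` unconditionally, `ExpClosure.EXP_subset_NEXP`; `NEXP ⊆ EXP` by
`NEXP_subset_EXP_of_sparse_reducible`). [cite: MurrayWilliams2017, Thm. 4.1 (p. 14)]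
[cite: MurrayWilliams2015, Thm. 4.1 (pp. 374–375)] -/
theorem MurrayWilliams2017_thm_4_1_holds : MurrayWilliams2017_thm_4_1 := fun hR hEXP =>
  Set.Subset.antisymm EXP_subset_NEXP (NEXP_subset_EXP_of_sparse_reducible hR hEXP)

/-- The use made of Thm. 4.1 in the proof of Thm. 1.6, now unconditional in Thm. 4.1: under Karp
`NP`-hardness of `MCSP`, `EXP ⊆ P/poly` forces `EXP = NEXP` (`exp_eq_nexp_of_isNPHard` of the
statement file fed with the discharge). [cite: MurrayWilliams2017, Thm. 4.1 and §4.1 (p. 14)] -/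
theorem exp_eq_nexp_of_isNPHard_MCSP (hhard : IsNPHard MCSP) (hEXP : EXP ⊆ PPoly) : EXP = NEXP :=
  exp_eq_nexp_of_isNPHard MurrayWilliams2017_thm_4_1_holds hhard hEXP

end Literature.Barriers.PneNP
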